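import Mathlib.Geometry.Manifold.Diffeomorph
import Mathlib.Geometry.Manifold.SmoothEmbedding
import Mathlib.Geometry.Manifold.ContMDiff.Atlas
import Mathlib.Geometry.Manifold.ContMDiff.NormedSpace
import Literature.Topology.FourManifolds.ChartTransport
import Literature.Topology.FourManifolds.SmoothOrientation
import HarnessLib

/-!
# Recharting a boundaryless manifold along a linear isomorphism of the model vector space

Topic `Literature/Topology/FourManifolds` (general differential topology; brick [A4] of the
discharge of `Literature.Topology.FourManifolds.nonempty_diffeomorph_of_isOrientedConnectedSum` at
arbitrary models, see `ConnectedSumUniquenessProofs.lean`).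

Many results of the tree are stated for manifolds charted on `ℝⁿ = EuclideanSpace ℝ (Fin n)`
with the model `𝓡 n` (e.g. the oriented disc theorem `exists_diffeomorph_apply_disc_eq` of
`OrientedConnectedSumUniqueness.lean`). A manifold `X` charted on an arbitrary real normed space
`E` of dimension `n` (model `𝓘(ℝ, E)`) becomes such a manifold after composing every chart with a
continuous linear isomorphism `L : E ≃L[ℝ] E'` (here `E' = ℝⁿ`): this file provides that
*recharting* as a type synonym `Literature.Topology.FourManifolds.Recharted X L` carrying
`ChartedSpace E'` and `IsManifold 𝓘(ℝ, E') ∞`, together with the transfer of the structures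
entering the disc theorem:

* `Recharted.of L : X ≃ Recharted X L` (the identity) and `Recharted.diffeomorph L`, the same map
  as a diffeomorphism `X ≃ₘ⟮𝓘(ℝ, E), 𝓘(ℝ, E')⟯ Recharted X L`; its differential is `L`
  (`Recharted.mfderiv_of`);
* `Recharted.isSmoothEmbedding_disc`: a disc `i : E → X` (smooth embedding of the model vector
  space) gives the disc `of L ∘ i ∘ L⁻¹ : E' → Recharted X L`;
* `SmoothOrientation.recharted`: an orientation of `X` gives one of `Recharted X L` (transport the
  pointwise orientations along `L`; the tangent coordinate changes are conjugated by `L`,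
  `Recharted.tangentCoordChange_eq`), and `Recharted.isOrientationPreserving_disc_iff`: the
  recharted disc preserves the transported orientations iff the disc preserves the original ones.

Mathlib has the companion construction in which the model *vector space* is changed but the
model space `H` is kept (`ModelWithCorners.transContinuousLinearEquiv`, with the identity
diffeomorphism `Diffeomorph.toTransContinuousLinearEquiv`); that does not produce a
`ChartedSpace E'` structure, which is what the `ℝⁿ`-charted statements of the tree consume, so
the present (equally formal) variant is needed. Everything is proved; no named facts.
-/

open scoped Manifold ContDiff Topology
open Set Function Filter OpenPartialHomeomorph Module

noncomputable section

namespace Literature.Topology.FourManifolds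

universe u

variable {E E' : Type*} [NormedAddCommGroup E] [NormedSpace ℝ E] [NormedAddCommGroup E']
  [NormedSpace ℝ E']

/-- **Recharting along a linear isomorphism of the model vector space.** `Recharted X L` is the
manifold `X` (charted on `E`) with every chart post-composed with `L : E ≃L[ℝ] E'`; as a type it
is `X` itself (a synonym, so that the `E'`-valued atlas does not interfere with the `E`-valued
one). [folklore] -/
@[nolint unusedArguments]
def Recharted (X : Type u) (_L : E ≃L[ℝ] E') : Type u := X

namespace Recharted

variable {X : Type u} (L : E ≃L[ℝ] E')

/-- The identity `X ≃ Recharted X L`. [folklore] -/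
def of : X ≃ Recharted X L := Equiv.refl X

/-- `of L` followed by its inverse is the identity (definitionally). [folklore] -/
@[simp] theorem of_symm_apply_of (x : X) : (of L).symm (of L x) = x := rfl

/-- The inverse of `of L` followed by `of L` is the identity (definitionally). [folklore] -/
@[simp] theorem of_apply_of_symm (x : Recharted X L) : of L ((of L).symm x) = x := rfl

variable [TopologicalSpace X]

/-- The topology of `Recharted X L` is that of `X`. [folklore] -/
instance instTopologicalSpace : TopologicalSpace (Recharted X L) := ‹TopologicalSpace X›

/-- `of L` is a homeomorphism (the identity). [folklore] -/
def ofHomeomorph : X ≃ₜ Recharted X L where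
  toEquiv := of L
  continuous_toFun := continuous_id
  continuous_invFun := continuous_id

/-- `ofHomeomorph L` is `of L` as a map. [folklore] -/
@[simp] theorem coe_ofHomeomorph : ⇑(ofHomeomorph L : X ≃ₜ Recharted X L) = of L := rfl

/-- The inverse of `ofHomeomorph L` is `(of L).symm` as a map. [folklore] -/
@[simp] theorem coe_ofHomeomorph_symm :
    ⇑(ofHomeomorph L : X ≃ₜ Recharted X L).symm = (of L).symm := rfl

/-- `Recharted X L` is Hausdorff if `X` is. [folklore] -/
instance instT2Space [T2Space X] : T2Space (Recharted X L) := ‹T2Space X›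

/-- `Recharted X L` is connected if `X` is. [folklore] -/
instance instConnectedSpace [ConnectedSpace X] : ConnectedSpace (Recharted X L) :=
  ‹ConnectedSpace X›

/-- `Recharted X L` is second countable if `X` is. [folklore] -/
instance instSecondCountableTopology [SecondCountableTopology X] :
    SecondCountableTopology (Recharted X L) := ‹SecondCountableTopology X›

/-- `Recharted X L` is nonempty if `X` is. [folklore] -/
instance instNonempty [Nonempty X] : Nonempty (Recharted X L) := ‹Nonempty X›

/-- The recharted chart: a chart `c` of `X` followed by `L`, as a chart of `Recharted X L`.
[folklore] -/
def rechart (c : OpenPartialHomeomorph X E) : OpenPartialHomeomorph (Recharted X L) E' :=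
  (ofHomeomorph L).symm.toOpenPartialHomeomorph.trans (c.transHomeomorph L.toHomeomorph)

/-- `rechart L c x = L (c x)`. [folklore] -/
@[simp] theorem rechart_apply (c : OpenPartialHomeomorph X E) (x : Recharted X L) :
    rechart L c x = L (c ((of L).symm x)) := rfl

/-- `(rechart L c).symm u = of L (c.symm (L.symm u))`. [folklore] -/
@[simp] theorem rechart_symm_apply (c : OpenPartialHomeomorph X E) (u : E') :
    (rechart L c).symm u = of L (c.symm (L.symm u)) := rfl

/-- The source of `rechart L c` is the source of `c`. [folklore] -/
@[simp] theorem rechart_source (c : OpenPartialHomeomorph X E) :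
    (rechart L c).source = (of L).symm ⁻¹' c.source := by
  simp [rechart]

/-- The target of `rechart L c` is `L '' c.target`. [folklore] -/
@[simp] theorem rechart_target (c : OpenPartialHomeomorph X E) :
    (rechart L c).target = L.symm ⁻¹' c.target := by
  ext u
  simp [rechart]

variable [ChartedSpace E X]

/-- **The recharted atlas**: the charts of `Recharted X L` are the charts of `X` followed by `L`.
[folklore] -/
instance instChartedSpace : ChartedSpace E' (Recharted X L) where
  atlas := rechart L '' atlas E X
  chartAt x := rechart L (chartAt E ((of L).symm x))
  mem_chart_source x := by simp
  chart_mem_atlas x := mem_image_of_mem _ (chart_mem_atlas E _)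

/-- The preferred chart of `Recharted X L` at `x`. [folklore] -/
theorem chartAt_eq (x : Recharted X L) : chartAt E' x = rechart L (chartAt E ((of L).symm x)) :=
  rfl

/-- **The recharted manifold is a `C^∞` manifold** for the model `𝓘(ℝ, E')`: its changes of
charts are those of `X` conjugated by `L`. [folklore] -/
instance instIsManifold [IsManifold 𝓘(ℝ, E) ∞ X] : IsManifold 𝓘(ℝ, E') ∞ (Recharted X L) := by
  apply isManifold_of_contDiffOn
  rintro _ _ ⟨c, hc, rfl⟩ ⟨c', hc', rfl⟩
  simp only [modelWithCornersSelf_coe, modelWithCornersSelf_coe_symm, CompTriple.comp_eq,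
    range_id, inter_univ, preimage_id_eq, id_eq]
  have h := ((contDiffGroupoid ∞ 𝓘(ℝ, E)).compatible_of_mem_maximalAtlas
    (IsManifold.subset_maximalAtlas hc) (IsManifold.subset_maximalAtlas hc')).1
  simp only [contDiffPregroupoid, modelWithCornersSelf_coe, modelWithCornersSelf_coe_symm,
    CompTriple.comp_eq, range_id, inter_univ, preimage_id_eq, id_eq] at h
  -- `h : ContDiffOn ℝ ∞ (c' ∘ c.symm) (c.symm ≫ c').source`
  have h2 : ContDiffOn ℝ ∞ ((L : E → E') ∘ (c.symm.trans c') ∘ (L.symm : E' → E))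
      (L.symm ⁻¹' (c.symm.trans c').source) :=
    L.contDiff.comp_contDiffOn (h.comp L.symm.contDiff.contDiffOn fun u hu => hu)
  refine h2.congr_mono (fun u _ => ?_) ?_
  · simp [rechart]
  · intro u hu
    simp only [trans_source, symm_source, rechart_target, mem_inter_iff, mem_preimage,
      rechart_symm_apply, rechart_source, of_symm_apply_of] at hu
    simp only [mem_preimage, trans_source, symm_source, mem_inter_iff]
    exact hu

/-! ### Extended charts; the identity diffeomorphism and its differential -/

/-- The extended chart of `Recharted X L` at `x`, as a map. [folklore] -/
theorem extChartAt_coe (x : Recharted X L) :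
    ⇑(extChartAt 𝓘(ℝ, E') x) = (L : E → E') ∘ chartAt E ((of L).symm x) ∘ (of L).symm := by
  ext y
  simp [extChartAt, chartAt_eq]

/-- The inverse extended chart of `Recharted X L` at `x`, as a map. [folklore] -/
theorem extChartAt_symm_coe (x : Recharted X L) :
    ⇑(extChartAt 𝓘(ℝ, E') x).symm = of L ∘ (chartAt E ((of L).symm x)).symm ∘ (L.symm : E' → E) := by
  ext u
  simp [extChartAt, chartAt_eq]

/-- The target of the extended chart of `Recharted X L` at `x`. [folklore] -/
theorem extChartAt_target' (x : Recharted X L) :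
    (extChartAt 𝓘(ℝ, E') x).target = L.symm ⁻¹' (chartAt E ((of L).symm x)).target := by
  simp [extChartAt, chartAt_eq]

variable [IsManifold 𝓘(ℝ, E) ∞ X]

/-- The identity `X → Recharted X L` is `C^∞` (in the charts `c` and `L ∘ c` it reads `L`).
[folklore] -/
theorem contMDiff_of : ContMDiff 𝓘(ℝ, E) 𝓘(ℝ, E') ∞ (of L : X → Recharted X L) := by
  refine contMDiff_of_locally_contMDiffOn fun x => ⟨(chartAt E x).source,
    (chartAt E x).open_source, mem_chart_source E x, ?_⟩
  set c := chartAt E x with hc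
  have h1 : ContMDiffOn 𝓘(ℝ, E) 𝓘(ℝ, E') ∞
      ((rechart L c).symm ∘ (L : E → E') ∘ c) c.source := by
    refine (contMDiffOn_chart_symm (I := 𝓘(ℝ, E')) (n := ∞) (x := of L x)).comp
      ((L : E →L[ℝ] E').contMDiff.comp_contMDiffOn (contMDiffOn_chart (x := x))) ?_
    intro y hy
    show L (c y) ∈ (chartAt E' (of L x)).target
    rw [chartAt_eq, rechart_target]
    simpa using c.map_source hy
  refine h1.congr fun y hy => ?_
  show of L y = (rechart L c).symm (L (c y))
  rw [rechart_symm_apply, L.symm_apply_apply, c.left_inv hy]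

/-- The identity `Recharted X L → X` is `C^∞`. [folklore] -/
theorem contMDiff_of_symm : ContMDiff 𝓘(ℝ, E') 𝓘(ℝ, E) ∞ ((of L).symm : Recharted X L → X) := by
  refine contMDiff_of_locally_contMDiffOn fun x => ⟨(chartAt E' x).source,
    (chartAt E' x).open_source, mem_chart_source E' x, ?_⟩
  set c := chartAt E ((of L).symm x) with hc
  have h1 : ContMDiffOn 𝓘(ℝ, E') 𝓘(ℝ, E) ∞
      (c.symm ∘ (L.symm : E' → E) ∘ rechart L c) (chartAt E' x).source := by
    refine (contMDiffOn_chart_symm (I := 𝓘(ℝ, E)) (n := ∞) (x := (of L).symm x)).comp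
      ((L.symm : E' →L[ℝ] E).contMDiff.comp_contMDiffOn (contMDiffOn_chart (I := 𝓘(ℝ, E')) (n := ∞) (x := x))) ?_
    intro y hy
    show L.symm (rechart L c y) ∈ c.target
    rw [chartAt_eq, rechart_source] at hy
    rw [rechart_apply, L.symm_apply_apply]
    exact c.map_source (x := (of L).symm y) hy
  refine h1.congr fun y hy => ?_
  rw [chartAt_eq, rechart_source] at hy
  show (of L).symm y = c.symm (L.symm (rechart L c y))
  rw [rechart_apply, L.symm_apply_apply]
  exact (c.left_inv (x := (of L).symm y) hy).symm

/-- **The identity `X ≃ Recharted X L` as a diffeomorphism** between the manifold `X` (model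
`𝓘(ℝ, E)`) and its recharting (model `𝓘(ℝ, E')`). [folklore] -/
def diffeomorph : X ≃ₘ⟮𝓘(ℝ, E), 𝓘(ℝ, E')⟯ Recharted X L where
  toEquiv := of L
  contMDiff_toFun := contMDiff_of L
  contMDiff_invFun := contMDiff_of_symm L

/-- `diffeomorph L` is `of L` as a map. [folklore] -/
@[simp] theorem coe_diffeomorph : ⇑(diffeomorph L : X ≃ₘ⟮𝓘(ℝ, E), 𝓘(ℝ, E')⟯ Recharted X L) = of L :=
  rfl

/-- The inverse of `diffeomorph L` is `(of L).symm` as a map. [folklore] -/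
@[simp] theorem coe_diffeomorph_symm :
    ⇑(diffeomorph L : X ≃ₘ⟮𝓘(ℝ, E), 𝓘(ℝ, E')⟯ Recharted X L).symm = (of L).symm :=
  rfl

/-- **The differential of the identity `X → Recharted X L` is `L`** (in the charts `c` at `x` and
`L ∘ c` at `of L x` the map reads `L` near the base point). [folklore] -/
theorem hasMFDerivAt_of (x : X) :
    HasMFDerivAt 𝓘(ℝ, E) 𝓘(ℝ, E') (of L : X → Recharted X L) x (L : E →L[ℝ] E') := by
  refine ⟨(contMDiff_of L).continuous.continuousAt, ?_⟩
  set c := chartAt E x with hc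
  have hev : writtenInExtChartAt 𝓘(ℝ, E) 𝓘(ℝ, E') x (of L : X → Recharted X L) =ᶠ[𝓝 (extChartAt 𝓘(ℝ, E) x x)]
      (L : E → E') := by
    have ht : c.target ∈ 𝓝 (extChartAt 𝓘(ℝ, E) x x) := by
      simpa using c.open_target.mem_nhds (c.map_source (mem_chart_source E x))
    filter_upwards [ht] with u hu
    have h1 : writtenInExtChartAt 𝓘(ℝ, E) 𝓘(ℝ, E') x (of L : X → Recharted X L) u =
        L (c (c.symm u)) := by
      simp [writtenInExtChartAt, extChartAt, chartAt_eq, hc]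
    rw [h1, c.right_inv hu]
  simp only [modelWithCornersSelf_coe, range_id, hasFDerivWithinAt_univ]
  exact (L : E →L[ℝ] E').hasFDerivAt.congr_of_eventuallyEq hev

/-- The differential of the identity `X → Recharted X L` at `x` is `L`. [folklore] -/
theorem mfderiv_of (x : X) :
    mfderiv 𝓘(ℝ, E) 𝓘(ℝ, E') (of L : X → Recharted X L) x = (L : E →L[ℝ] E') :=
  (hasMFDerivAt_of L x).mfderiv

/-! ### Discs -/

variable [FiniteDimensional ℝ E]

/-- **Transfer of a disc to the recharted manifold.** If `i : E → X` is a smooth embedding of the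
model vector space (a disc), then `of L ∘ i ∘ L⁻¹ : E' → Recharted X L` is a smooth embedding for
the models `𝓘(ℝ, E')`, `𝓘(ℝ, E')`: it is a partial diffeomorphism of source `E'`
(`isSmoothEmbedding_of_openPartialHomeomorph`, the inverse of `i` being smooth on its open range,
`exists_chart_of_isSmoothEmbedding`). [folklore] -/
theorem isSmoothEmbedding_disc {i : E → X} (hi : Manifold.IsSmoothEmbedding 𝓘(ℝ, E) 𝓘(ℝ, E) ∞ i) :
    Manifold.IsSmoothEmbedding 𝓘(ℝ, E') 𝓘(ℝ, E') ∞
      (of L ∘ i ∘ (L.symm : E' → E) : E' → Recharted X L) := by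
  haveI : FiniteDimensional ℝ E' := LinearEquiv.finiteDimensional L.toLinearEquiv
  obtain ⟨Φ₀, hΦ₀t, hΦ₀s, hΦ₀src, hΦ₀c⟩ := exists_chart_of_isSmoothEmbedding hi
  -- the partial diffeomorphism `E' → Recharted X L` with source `E'` agreeing with the disc
  set Φ : OpenPartialHomeomorph E' (Recharted X L) :=
    (L.symm.toHomeomorph.toOpenPartialHomeomorph.trans Φ₀.symm).trans
      (ofHomeomorph L).toOpenPartialHomeomorph with hΦ
  have hΦcoe : ⇑Φ = of L ∘ i ∘ (L.symm : E' → E) := by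
    ext u
    simp [hΦ, hΦ₀s]
  have hΦsrc : Φ.source = univ := by
    simp [hΦ, hΦ₀t]
  have hΦc : ContMDiffOn 𝓘(ℝ, E') 𝓘(ℝ, E') ∞ Φ Φ.source := by
    rw [hΦcoe, hΦsrc]
    exact ((contMDiff_of L).comp (hi.contMDiff.comp (L.symm : E' →L[ℝ] E).contMDiff)).contMDiffOn
  have hΦsymm : ⇑Φ.symm = (L : E → E') ∘ Φ₀ ∘ (of L).symm := by
    ext u
    simp [hΦ]
  have hΦc' : ContMDiffOn 𝓘(ℝ, E') 𝓘(ℝ, E') ∞ Φ.symm Φ.target := by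
    have h1 : ContMDiffOn 𝓘(ℝ, E') 𝓘(ℝ, E') ∞ ((L : E → E') ∘ Φ₀ ∘ (of L).symm)
        ((of L).symm ⁻¹' Φ₀.source) :=
      (L : E →L[ℝ] E').contMDiff.comp_contMDiffOn
        (hΦ₀c.comp (contMDiff_of_symm L).contMDiffOn fun _ hu => hu)
    rw [hΦsymm]
    refine h1.mono fun u hu => ?_
    -- `u = Φ (Φ.symm u)` exhibits `(of L).symm u` as a point of `range i = Φ₀.source`
    have h2 : Φ (Φ.symm u) = u := Φ.right_inv hu
    rw [hΦcoe, hΦsymm] at h2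
    show (of L).symm u ∈ Φ₀.source
    rw [hΦ₀src]
    exact ⟨L.symm (L (Φ₀ ((of L).symm u))), congrArg (of L).symm h2⟩
  rw [← hΦcoe]
  exact isSmoothEmbedding_of_openPartialHomeomorph Φ hΦsrc hΦc hΦc' (ContinuousLinearEquiv.refl ℝ E')

end Recharted

/-! ### Orientations -/

section Orientation

/-- **Transport of orientations of the model vector space along `L : E ≃L[ℝ] E'`**: map the
orientation by `L` and reindex `Fin (finrank E) ≃ Fin (finrank E')`. [folklore] -/
def orientationCongr (L : E ≃L[ℝ] E') :
    Orientation ℝ E (Fin (finrank ℝ E)) ≃ Orientation ℝ E' (Fin (finrank ℝ E')) :=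
  (Orientation.map (Fin (finrank ℝ E)) L.toLinearEquiv).trans
    (Orientation.reindex ℝ E' (finCongr L.toLinearEquiv.finrank_eq))

/-- `orientationCongr` commutes with negation. [folklore] -/
@[simp] theorem orientationCongr_neg (L : E ≃L[ℝ] E') (o : Orientation ℝ E (Fin (finrank ℝ E))) :
    orientationCongr L (-o) = -orientationCongr L o := by
  simp [orientationCongr, Orientation.map_neg, Orientation.reindex_neg]

/-- Conjugating by `L` does not change the determinant (continuous linear maps). [folklore] -/
theorem det_continuousLinearEquiv_conj (L : E ≃L[ℝ] E') (T : E →L[ℝ] E) :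
    LinearMap.det (((L : E →L[ℝ] E').comp (T.comp (L.symm : E' →L[ℝ] E))).toLinearMap) =
      LinearMap.det T.toLinearMap := by
  have : ((L : E →L[ℝ] E').comp (T.comp (L.symm : E' →L[ℝ] E))).toLinearMap =
      (L.toLinearEquiv : E →ₗ[ℝ] E') ∘ₗ T.toLinearMap ∘ₗ (L.toLinearEquiv.symm : E' →ₗ[ℝ] E) := by
    rfl
  rw [this, LinearMap.det_conj]

namespace Recharted

variable {X : Type u} (L : E ≃L[ℝ] E') [TopologicalSpace X] [ChartedSpace E X]
  [IsManifold 𝓘(ℝ, E) ∞ X]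

/-- **The tangent coordinate changes of `Recharted X L` are those of `X` conjugated by `L`.**
[folklore] -/
theorem tangentCoordChange_eq (x y z : Recharted X L) :
    tangentCoordChange 𝓘(ℝ, E') x y z =
      (L : E →L[ℝ] E').comp ((tangentCoordChange 𝓘(ℝ, E) ((of L).symm x) ((of L).symm y)
        ((of L).symm z)).comp (L.symm : E' →L[ℝ] E)) := by
  rw [tangentCoordChange_def, tangentCoordChange_def]
  simp only [modelWithCornersSelf_coe, range_id, fderivWithin_univ]
  rw [extChartAt_coe, extChartAt_symm_coe, extChartAt_coe]
  set cx := chartAt E ((of L).symm x) with hcx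
  set cy := chartAt E ((of L).symm y) with hcy
  have hcomp : ((L : E → E') ∘ ⇑cy ∘ ⇑(of L).symm) ∘ ⇑(of L) ∘ ⇑cx.symm ∘ ⇑L.symm =
      (L : E → E') ∘ (cy ∘ cx.symm) ∘ (L.symm : E' → E) := by
    ext u; simp
  have hpt : ((L : E → E') ∘ ⇑cx ∘ ⇑(of L).symm) z = L (cx ((of L).symm z)) := rfl
  have e1 : (⇑(extChartAt 𝓘(ℝ, E) ((of L).symm y)) ∘ ⇑(extChartAt 𝓘(ℝ, E) ((of L).symm x)).symm) =
      cy ∘ cx.symm := by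
    ext u; simp [hcx, hcy]
  have e2 : extChartAt 𝓘(ℝ, E) ((of L).symm x) ((of L).symm z) = cx ((of L).symm z) := by
    simp [hcx]
  rw [hcomp, hpt, L.comp_fderiv, L.symm.comp_right_fderiv, L.symm_apply_apply, e1, e2]

end Recharted

/-- **The orientation of the recharted manifold** induced by an orientation of `X`: at `x` it is
the orientation of `X` at `x` transported along `L`. Local constancy transfers because the
tangent coordinate changes are conjugated by `L` (`Recharted.tangentCoordChange_eq`), which does
not change determinants. [folklore] -/
def SmoothOrientation.recharted {X : Type u} [TopologicalSpace X] [ChartedSpace E X]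
    [IsManifold 𝓘(ℝ, E) ∞ X] (L : E ≃L[ℝ] E') (o : SmoothOrientation 𝓘(ℝ, E) X) :
    SmoothOrientation 𝓘(ℝ, E') (Recharted X L) where
  toFun x := orientationCongr L (o ((Recharted.of L).symm x))
  eventually_eq_iff' x := by
    have h := o.eventually_eq_iff ((Recharted.of L).symm x)
    filter_upwards [(Recharted.contMDiff_of_symm L).continuous.continuousAt.eventually h] with y hy
    rw [(orientationCongr L).apply_eq_iff_eq, hy, Recharted.tangentCoordChange_eq,
      det_continuousLinearEquiv_conj]

namespace Recharted

variable {X : Type u} (L : E ≃L[ℝ] E') [TopologicalSpace X] [ChartedSpace E X]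
  [IsManifold 𝓘(ℝ, E) ∞ X]

/-- The recharted orientation at `x` is the transported orientation of `X` at `x`. [folklore] -/
@[simp] theorem _root_.Literature.Topology.FourManifolds.SmoothOrientation.recharted_apply
    (o : SmoothOrientation 𝓘(ℝ, E) X) (x : Recharted X L) :
    o.recharted L x = orientationCongr L (o ((of L).symm x)) := rfl

/-- Recharting commutes with reversing the orientation. [folklore] -/
@[simp] theorem _root_.Literature.Topology.FourManifolds.SmoothOrientation.recharted_neg
    (o : SmoothOrientation 𝓘(ℝ, E) X) : (-o).recharted L = -o.recharted L := by
  ext x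
  simp

/-- The differential of the recharted disc `of L ∘ i ∘ L⁻¹` at `L y` is the differential of `i`
at `y` conjugated by `L`. [folklore] -/
theorem mfderiv_disc {i : E → X} (hi : MDifferentiable 𝓘(ℝ, E) 𝓘(ℝ, E) i) (y : E) :
    mfderiv 𝓘(ℝ, E') 𝓘(ℝ, E') (of L ∘ i ∘ (L.symm : E' → E) : E' → Recharted X L) (L y) =
      (L : E →L[ℝ] E').comp ((mfderiv 𝓘(ℝ, E) 𝓘(ℝ, E) i y).comp (L.symm : E' →L[ℝ] E)) := by
  have hL : HasMFDerivAt 𝓘(ℝ, E') 𝓘(ℝ, E) (L.symm : E' → E) (L y) (L.symm : E' →L[ℝ] E) :=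
    L.symm.hasFDerivAt.hasMFDerivAt
  have hi' : HasMFDerivAt 𝓘(ℝ, E) 𝓘(ℝ, E) i (L.symm (L y)) (mfderiv 𝓘(ℝ, E) 𝓘(ℝ, E) i y) := by
    rw [L.symm_apply_apply]; exact (hi y).hasMFDerivAt
  have ho : HasMFDerivAt 𝓘(ℝ, E) 𝓘(ℝ, E') (of L : X → Recharted X L) (i (L.symm (L y)))
      (L : E →L[ℝ] E') := hasMFDerivAt_of L _
  exact ((ho.comp (L.symm (L y)) hi').comp (L y) hL).mfderiv

/-- **The recharted disc preserves the transported orientations iff the disc preserves the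
original ones**: for a differentiable disc `i : E → X`, a constant orientation `o₀` of `E` and
an orientation `o` of `X`, `of L ∘ i ∘ L⁻¹` preserves `(orientationCongr L o₀, o.recharted L)`
iff `i` preserves `(o₀, o)` (same comparison of orientations; the differentials are conjugated
by `L`). [folklore] -/
theorem isOrientationPreserving_disc_iff {i : E → X} (hi : MDifferentiable 𝓘(ℝ, E) 𝓘(ℝ, E) i)
    {o₀ : Orientation ℝ E (Fin (finrank ℝ E))} {o : SmoothOrientation 𝓘(ℝ, E) X} :
    IsOrientationPreserving (SmoothOrientation.modelSpace (orientationCongr L o₀)) (o.recharted L)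
        (of L ∘ i ∘ (L.symm : E' → E) : E' → Recharted X L) ↔
      IsOrientationPreserving (SmoothOrientation.modelSpace o₀) o i := by
  have key : ∀ y : E,
      LinearMap.det (M := E') (mfderiv 𝓘(ℝ, E') 𝓘(ℝ, E')
        (of L ∘ i ∘ (L.symm : E' → E) : E' → Recharted X L) (L y)).toLinearMap =
      LinearMap.det (M := E) (mfderiv 𝓘(ℝ, E) 𝓘(ℝ, E) i y).toLinearMap := fun y => by
    rw [mfderiv_disc L hi y]
    exact det_continuousLinearEquiv_conj L _
  have key' : ∀ y : E,
      ((o.recharted L) ((of L ∘ i ∘ (L.symm : E' → E) : E' → Recharted X L) (L y)) =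
          SmoothOrientation.modelSpace (orientationCongr L o₀) (L y)) ↔
        (o (i y) = SmoothOrientation.modelSpace o₀ y) := fun y => by
    simp only [comp_apply, SmoothOrientation.recharted_apply, of_symm_apply_of,
      ContinuousLinearEquiv.symm_apply_apply, SmoothOrientation.modelSpace_apply]
    exact (orientationCongr L).apply_eq_iff_eq
  constructor
  · intro h y
    have hy := h (L y)
    rw [key y, key' y] at hy
    exact hy
  · intro h y'
    obtain ⟨y, rfl⟩ := L.surjective y'
    show _ ↔ _
    rw [key y, key' y]
    exact h y

/-- The recharted disc reverses the transported orientations iff the disc reverses the original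
ones. [folklore] -/
theorem isOrientationReversing_disc_iff {i : E → X} (hi : MDifferentiable 𝓘(ℝ, E) 𝓘(ℝ, E) i)
    {o₀ : Orientation ℝ E (Fin (finrank ℝ E))} {o : SmoothOrientation 𝓘(ℝ, E) X} :
    IsOrientationReversing (SmoothOrientation.modelSpace (orientationCongr L o₀)) (o.recharted L)
        (of L ∘ i ∘ (L.symm : E' → E) : E' → Recharted X L) ↔
      IsOrientationReversing (SmoothOrientation.modelSpace o₀) o i := by
  rw [isOrientationReversing_iff, isOrientationReversing_iff,
    ← SmoothOrientation.recharted_neg]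
  exact isOrientationPreserving_disc_iff L hi

end Recharted

end Orientation

end Literature.Topology.FourManifolds
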